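import Summits.AtomisticToContinuum.HydrodynamicLimit.Theses.JaynesSqueeze

/-!
# Birth skeleton — crux `NoMeanEntropyProduction` (stmt-AtomisticToContinuum-13437), route `JaynesSqueeze`

BC3 skeleton of the crux K1 `Summit.AtomisticToContinuum.HydrodynamicLimit.Theses.JaynesSqueeze.NoMeanEntropyProduction`
(planner one-shot `skel-stmt-AtomisticToContinuum-13437`, 2026-08-17; line card `Lines/birth.md`).

K1 says: before the first shock and in the dilute band, the hard-sphere thermodynamic entropy
`𝒮^m_N(s) = Σ_B m_B s_σ(m³ m_B, θ_B)` of the BLOCK-AVERAGED MEAN one-body profile of the evolved local Gibbs law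
is asymptotically at most the entropy `𝒮[U(s)] = ∫ ρ_s s_σ(ρ_s, θ_s)` of the classical Euler solution, uniformly on
`[0, t]`. The skeleton is the TIME-ZERO ANCHORING of that inequality — three named stubs and a proved composition:

* `Stubs.stub_initialCoarseGraining` (S0, static, M): coarse-graining consistency AT TIME ZERO —
  `𝒮^m_N(0) ≤ 𝒮[U(0)] + δ` for `m ≥ m₀(δ)`, eventually in `N` (LDA mean-density limit of the intensity measure of
  the local Gibbs law + exactly Maxwellian velocities given positions + Riemann sums of the continuous data; the
  Jensen gap of the cube average is `O(m⁻²)`; data pinning `U(0) = (ρ_{a₀}, u₀, θ₀)` by the law of large numbers);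
* `Stubs.stub_eulerEntropyConservation` (S1, PDE, S–M): GUARDED ISENTROPY of classical hard-sphere Euler
  solutions — there is a band `ηc > 0` such that a classical solution with packing `ρσ³ ≤ ηc` on `[0, t]` has
  `𝒮[U(s)] = 𝒮[U(0)]` for `s ∈ [0, t]` (core landed: `Theorems.JaynesSqueezeClosure.integral_entropy_eq`, which
  asks the band on all of `[0, T)`; what remains is restriction of the solution to `[0, t']` / continuity at
  `s = t`, and the band from `HsEosLowDensity`, proved);
* `Stubs.stub_noCoarseEntropyGain` (S2, dynamical, the hard core, open-problem): NO COARSE-GRAINED ENTROPY GAIN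
  ALONG THE HARD-SPHERE FLOW — `𝒮^m_N(s) ≤ 𝒮^m_N(0) + δ` uniformly on `[0, t]`, eventually in `N`: an
  anti-H-theorem for the MEAN block profile at Euler scaling (self-comparison of the particle system; no Euler
  solution in the conclusion). This is where the route's foreseen cut FluxWorkBudget → EntropyBalanceOfMeanProfile
  applies (route header, TWO-LAYER PLAN); it is NOT equivalent to K1 by cheap means (needs S0 and the Clausius
  direction at time zero one way, S0 + S1 the other).

`NoMeanEntropyProduction_of : stub_initialCoarseGraining → stub_eulerEntropyConservation → stub_noCoarseEntropyGain →
NoMeanEntropyProduction` is a REAL proof (thresholds `σ₀ = min`, `ηc = min`, `m₀ = max`, intersection of the two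
eventualities, `δ/2 + δ/2`, and the isentropy rewrite); `NoMeanEntropyProduction_skeleton` feeds it the stubs.
The block quantities of the stubs are the crux's `let`-abbreviations written as universally quantified
where-variables pinned by equations (`∀ P, Eq P (…) → …`, i.e. `P = …`, written with `Eq` so the right side elaborates against the declared type; instantiate with `_ rfl`), so that no `:=` occurs inside a
registered signature. `lean check`: rc 0, `sorry` exactly in the three `Stubs.stub_*`, nowhere else.
Disproof.lean: none exists for this crux (no `_false_without_` obligations to honour); negatives index checked
(the junk-EOS witness of stmt-9168 is excluded by the `ηc` band of S1 and the packing guard of S2).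
-/

namespace Summit.AtomisticToContinuum.HydrodynamicLimit.Cruxes.NoMeanEntropyProduction.Birth

open Summit.AtomisticToContinuum.HydrodynamicLimit.Theses.JaynesSqueeze

namespace Stubs

/-- **Stub S0 — coarse-graining consistency at time zero** (static; M). For continuous positive profiles there
is `σ₀` such that for `σ < σ₀`, every classical hs-Euler solution `(ρ, u, θ)` on `[0, T)`, `T > 0`, every flow
family and the conjunct's `t = 0` law of large numbers: `∀ δ > 0 ∃ m₀ ∀ m ≥ m₀`, eventually in `N`, the block
entropy of the time-zero intensity measure is at most `∫ ρ₀ s_σ(ρ₀, θ₀) dx + δ` (`ρ₀ = ρ 0`, `θ₀ = θ 0`, pinned to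
the data by the LLN). Why plausibly true: velocities given positions are exactly Maxwellian `(u₀(x), θ₀(x))` under
the local Gibbs law; block masses converge to `∫_B ρ_{a₀}` (HardSphereLDA (B), proved); the cube-average Jensen
gap and the in-block variance of `u₀` vanish as `m → ∞` by uniform continuity. Leans on:
`Theorems.JaynesSqueezeSqueeze.*` (intensity / block lemmas, `tendsto_timeZero_term`-type limits),
`Theorems.hardSphereLDA_proof`, `localGibbs_lln_holds`, `EntropyClockDock.data_eq_of_ties`. -/
theorem stub_initialCoarseGraining :
    ∀ (a₀ θ₀ : (UnitAddTorus (Fin 3)) → ℝ) (u₀ : (UnitAddTorus (Fin 3)) → (EuclideanSpace ℝ (Fin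
      3))), Continuous a₀ → Continuous θ₀ → Continuous u₀ → (∀ x, 0 < a₀ x) → (∀ x, 0 < θ₀ x) → ∃
      σ₀ : ℝ, 0 < σ₀ ∧ ∀ σ : ℝ, 0 < σ → σ < σ₀ → ∀ (T : ℝ) (ρ θ : ℝ → (UnitAddTorus (Fin 3)) → ℝ)
      (u : ℝ → (UnitAddTorus (Fin 3)) → (EuclideanSpace ℝ (Fin 3))),
      Literature.MathematicalPhysics.KineticTheory.IsHardSphereEulerSolution σ T ρ u θ → ∀ Φ : (N :
      ℕ) → Literature.Analysis.FluidPDE.HardSphereFlow (Literature.Analysis.FluidPDE.Torus.geometry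
      (Fin 3)) (Literature.MathematicalPhysics.KineticTheory.hsDiameter σ N) (N + 1),
      Literature.MathematicalPhysics.KineticTheory.TendstoHydroFieldsAt (fun N =>
      Literature.MathematicalPhysics.KineticTheory.localGibbsLaw σ a₀ u₀ θ₀ N (Φ N)) Φ ρ u θ 0 → 0
      < T → ∀ P : (N : ℕ) → MeasureTheory.Measure (Literature.Analysis.FluidPDE.Config (N + 1) (Fin
      3) (UnitAddTorus (Fin 3))), Eq P (fun N =>
      Literature.MathematicalPhysics.KineticTheory.localGibbsLaw σ a₀ u₀ θ₀ N (Φ N)) → ∀ μ : (N :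
      ℕ) → ℝ → MeasureTheory.Measure ((UnitAddTorus (Fin 3)) × (EuclideanSpace ℝ (Fin 3))), Eq μ
      (fun N s => ((N : ENNReal) + 1)⁻¹ • MeasureTheory.Measure.sum (fun i : Fin (N + 1) => ((Φ
      N).lawAt (P N) s).map (fun z => z i))) → ∀ idx : ℕ → (UnitAddTorus (Fin 3)) → (Fin 3 → ℕ), Eq
      idx (fun m x i => ⌊(m : ℝ) * Literature.Analysis.FunctionSpaces.Torus.repr x i⌋₊) → ∀ μB : ℕ
      → ℝ → ℕ → (Fin 3 → ℕ) → MeasureTheory.Measure (EuclideanSpace ℝ (Fin 3)), Eq μB (fun N s m k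
      => ((μ N s).restrict ({x : (UnitAddTorus (Fin 3)) | idx m x = k} ×ˢ (Set.univ : Set
      (EuclideanSpace ℝ (Fin 3))))).snd) → ∀ mass : ℕ → ℝ → ℕ → (Fin 3 → ℕ) → ℝ, Eq mass (fun N s m
      k => ((μB N s m k) Set.univ).toReal) → ∀ vel : ℕ → ℝ → ℕ → (Fin 3 → ℕ) → (EuclideanSpace ℝ
      (Fin 3)), Eq vel (fun N s m k => (mass N s m k)⁻¹ • ∫ v, v ∂(μB N s m k)) → ∀ temp : ℕ → ℝ →
      ℕ → (Fin 3 → ℕ) → ℝ, Eq temp (fun N s m k => (3 * mass N s m k)⁻¹ * ∫ v, ‖v - vel N s m k‖ ^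
      2 ∂(μB N s m k)) → ∀ ent : ℝ → ℝ → ℝ, Eq ent (fun r ϑ => 3 / 2 * Real.log ϑ - Real.log r -
      Literature.MathematicalPhysics.KineticTheory.hsExcessFreeEnergy (r * σ ^ 3)) → ∀ Sblk : ℕ → ℝ
      → ℕ → ℝ, Eq Sblk (fun N s m => ∑ k ∈ Fintype.piFinset (fun _ : Fin 3 => Finset.range m), mass
      N s m k * ent ((m : ℝ) ^ 3 * mass N s m k) (temp N s m k)) → ∀ δ : ℝ, 0 < δ → ∃ m₀ : ℕ, ∀ m :
      ℕ, m₀ ≤ m → ∀ᶠ N : ℕ in Filter.atTop, Sblk N 0 m ≤ (∫ x, ρ 0 x * ent (ρ 0 x) (θ 0 x)) + δ := by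
  sorry

/-- **Stub S1 — guarded isentropy of classical hard-sphere Euler solutions** (PDE; S–M). There is a band
`ηc > 0` such that for every `σ > 0`, every classical hs-Euler solution on `[0, T)`, every `t < T` with packing
`ρ_s σ³ ≤ ηc` on `[0, t] × 𝕋³`, the thermodynamic entropy `∫ ρ_s (3/2 log θ_s − log ρ_s − f_ex(ρ_s σ³))` equals its
time-zero value for all `s ∈ [0, t]`. Why true: `Theorems.JaynesSqueezeClosure.integral_entropy_eq` (landed) under
the band on all of `[0, T)` with `f_ex` smooth there (`HsEosLowDensity`, proved: analytic on `[0, η₀)`); take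
`ηc < η₀` and restrict the solution to `[0, t′]`, `t < t′`, by continuity of `ρ` (or pass to `s = t` by continuity
of the entropy integral). -/
theorem stub_eulerEntropyConservation :
    ∃ ηc : ℝ, 0 < ηc ∧ ∀ σ : ℝ, 0 < σ → ∀ (T : ℝ) (ρ θ : ℝ → (UnitAddTorus (Fin 3)) → ℝ) (u : ℝ →
      (UnitAddTorus (Fin 3)) → (EuclideanSpace ℝ (Fin 3))),
      Literature.MathematicalPhysics.KineticTheory.IsHardSphereEulerSolution σ T ρ u θ → ∀ t ∈
      Set.Ico 0 T, (∀ s ∈ Set.Icc 0 t, ∀ x, ρ s x * σ ^ 3 ≤ ηc) → ∀ s ∈ Set.Icc 0 t, (∫ x, ρ s x *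
      (3 / 2 * Real.log (θ s x) - Real.log (ρ s x) -
      Literature.MathematicalPhysics.KineticTheory.hsExcessFreeEnergy (ρ s x * σ ^ 3))) = ∫ x, ρ 0
      x * (3 / 2 * Real.log (θ 0 x) - Real.log (ρ 0 x) -
      Literature.MathematicalPhysics.KineticTheory.hsExcessFreeEnergy (ρ 0 x * σ ^ 3)) := by
  sorry

/-- **Stub S2 — no coarse-grained entropy gain along the hard-sphere flow** (dynamical; the hard core,
open-problem). Same hypotheses as the crux (profiles, `σ < σ₀`, classical solution, flows, `t = 0` LLN, `t < T`,
packing guard `ρ_s σ³ ≤ ηc` on `[0, t]`): `∀ δ > 0 ∃ m₀ ∀ m ≥ m₀`, eventually in `N`, for all `s ∈ [0, t]` the block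
entropy of the MEAN one-body profile at time `s` exceeds its time-zero value by at most `δ`:
`𝒮^m_N(s) ≤ 𝒮^m_N(0) + δ`. An anti-H-theorem for the coarse-grained mean profile at Euler scaling before the
shock: false for free streaming (phase mixing heats the blocks), conjunct-strength for hard spheres; the physical
content of K1 with the Euler solution removed from the conclusion. Foreseen cut (route header): an entropy
balance of the mean block profile + a flux-work budget `∫₀ᵗ∫(Π̄ − p𝟙):∇ū ≥ −o(1)`. -/
theorem stub_noCoarseEntropyGain :
    ∀ (a₀ θ₀ : (UnitAddTorus (Fin 3)) → ℝ) (u₀ : (UnitAddTorus (Fin 3)) → (EuclideanSpace ℝ (Fin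
      3))), Continuous a₀ → Continuous θ₀ → Continuous u₀ → (∀ x, 0 < a₀ x) → (∀ x, 0 < θ₀ x) → ∃
      σ₀ : ℝ, 0 < σ₀ ∧ ∃ ηc : ℝ, 0 < ηc ∧ ∀ σ : ℝ, 0 < σ → σ < σ₀ → ∀ (T : ℝ) (ρ θ : ℝ →
      (UnitAddTorus (Fin 3)) → ℝ) (u : ℝ → (UnitAddTorus (Fin 3)) → (EuclideanSpace ℝ (Fin 3))),
      Literature.MathematicalPhysics.KineticTheory.IsHardSphereEulerSolution σ T ρ u θ → ∀ Φ : (N :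
      ℕ) → Literature.Analysis.FluidPDE.HardSphereFlow (Literature.Analysis.FluidPDE.Torus.geometry
      (Fin 3)) (Literature.MathematicalPhysics.KineticTheory.hsDiameter σ N) (N + 1),
      Literature.MathematicalPhysics.KineticTheory.TendstoHydroFieldsAt (fun N =>
      Literature.MathematicalPhysics.KineticTheory.localGibbsLaw σ a₀ u₀ θ₀ N (Φ N)) Φ ρ u θ 0 → ∀
      t ∈ Set.Ico 0 T, (∀ s ∈ Set.Icc 0 t, ∀ x, ρ s x * σ ^ 3 ≤ ηc) → ∀ P : (N : ℕ) →
      MeasureTheory.Measure (Literature.Analysis.FluidPDE.Config (N + 1) (Fin 3) (UnitAddTorus (Fin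
      3))), Eq P (fun N => Literature.MathematicalPhysics.KineticTheory.localGibbsLaw σ a₀ u₀ θ₀ N
      (Φ N)) → ∀ μ : (N : ℕ) → ℝ → MeasureTheory.Measure ((UnitAddTorus (Fin 3)) × (EuclideanSpace
      ℝ (Fin 3))), Eq μ (fun N s => ((N : ENNReal) + 1)⁻¹ • MeasureTheory.Measure.sum (fun i : Fin
      (N + 1) => ((Φ N).lawAt (P N) s).map (fun z => z i))) → ∀ idx : ℕ → (UnitAddTorus (Fin 3)) →
      (Fin 3 → ℕ), Eq idx (fun m x i => ⌊(m : ℝ) * Literature.Analysis.FunctionSpaces.Torus.repr x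
      i⌋₊) → ∀ μB : ℕ → ℝ → ℕ → (Fin 3 → ℕ) → MeasureTheory.Measure (EuclideanSpace ℝ (Fin 3)), Eq
      μB (fun N s m k => ((μ N s).restrict ({x : (UnitAddTorus (Fin 3)) | idx m x = k} ×ˢ (Set.univ
      : Set (EuclideanSpace ℝ (Fin 3))))).snd) → ∀ mass : ℕ → ℝ → ℕ → (Fin 3 → ℕ) → ℝ, Eq mass (fun
      N s m k => ((μB N s m k) Set.univ).toReal) → ∀ vel : ℕ → ℝ → ℕ → (Fin 3 → ℕ) →
      (EuclideanSpace ℝ (Fin 3)), Eq vel (fun N s m k => (mass N s m k)⁻¹ • ∫ v, v ∂(μB N s m k)) →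
      ∀ temp : ℕ → ℝ → ℕ → (Fin 3 → ℕ) → ℝ, Eq temp (fun N s m k => (3 * mass N s m k)⁻¹ * ∫ v, ‖v
      - vel N s m k‖ ^ 2 ∂(μB N s m k)) → ∀ ent : ℝ → ℝ → ℝ, Eq ent (fun r ϑ => 3 / 2 * Real.log ϑ
      - Real.log r - Literature.MathematicalPhysics.KineticTheory.hsExcessFreeEnergy (r * σ ^ 3)) →
      ∀ Sblk : ℕ → ℝ → ℕ → ℝ, Eq Sblk (fun N s m => ∑ k ∈ Fintype.piFinset (fun _ : Fin 3 =>
      Finset.range m), mass N s m k * ent ((m : ℝ) ^ 3 * mass N s m k) (temp N s m k)) → ∀ δ : ℝ, 0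
      < δ → ∃ m₀ : ℕ, ∀ m : ℕ, m₀ ≤ m → ∀ᶠ N : ℕ in Filter.atTop, ∀ s ∈ Set.Icc 0 t, Sblk N s m ≤
      Sblk N 0 m + δ := by
  sorry


end Stubs

/-- Statement of registered stub S0 (`Stubs.stub_initialCoarseGraining`), by name. -/
def stub_initialCoarseGraining : Prop := type_of% Stubs.stub_initialCoarseGraining

/-- Statement of registered stub S1 (`Stubs.stub_eulerEntropyConservation`), by name. -/
def stub_eulerEntropyConservation : Prop := type_of% Stubs.stub_eulerEntropyConservation

/-- Statement of registered stub S2 (`Stubs.stub_noCoarseEntropyGain`), by name. -/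
def stub_noCoarseEntropyGain : Prop := type_of% Stubs.stub_noCoarseEntropyGain

/-- **The composition (REAL proof, no `sorry`): S0 → S1 → S2 → K1.** Thresholds `σ₀ = min σ_A σ_C`,
`ηc = min η_B η_C`; given `δ`, run S2 and S0 with `δ/2`, take `m₀ = max`, intersect the two eventualities in `N`;
for `s ∈ [0, t]`: `𝒮^m_N(s) ≤ 𝒮^m_N(0) + δ/2 ≤ 𝒮[U(0)] + δ = 𝒮[U(s)] + δ` by S1. [folklore] -/
theorem NoMeanEntropyProduction_of (h0 : stub_initialCoarseGraining) (h1 : stub_eulerEntropyConservation)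
    (h2 : stub_noCoarseEntropyGain) : NoMeanEntropyProduction := by
  have H0 : type_of% Stubs.stub_initialCoarseGraining := h0
  have H1 : type_of% Stubs.stub_eulerEntropyConservation := h1
  have H2 : type_of% Stubs.stub_noCoarseEntropyGain := h2
  intro a₀ θ₀ u₀ ha hθ hu ha0 hθ0
  obtain ⟨σA, hσA, HA⟩ := H0 a₀ θ₀ u₀ ha hθ hu ha0 hθ0
  obtain ⟨ηB, hηB, HB⟩ := H1
  obtain ⟨σC, hσC, ηC, hηC, HC⟩ := H2 a₀ θ₀ u₀ ha hθ hu ha0 hθ0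
  refine ⟨min σA σC, lt_min hσA hσC, min ηB ηC, lt_min hηB hηC, ?_⟩
  intro σ hσ hσlt T ρ θ u hE Φ hLLN t ht hguard
  dsimp only
  intro δ hδ
  have hT : 0 < T := ht.1.trans_lt ht.2
  have hσA' : σ < σA := hσlt.trans_le (min_le_left _ _)
  have hσC' : σ < σC := hσlt.trans_le (min_le_right _ _)
  have hguardB : ∀ s ∈ Set.Icc 0 t, ∀ x, ρ s x * σ ^ 3 ≤ ηB := fun s hs x =>
    (hguard s hs x).trans (min_le_left _ _)
  have hguardC : ∀ s ∈ Set.Icc 0 t, ∀ x, ρ s x * σ ^ 3 ≤ ηC := fun s hs x =>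
    (hguard s hs x).trans (min_le_right _ _)
  have hA := HA σ hσ hσA' T ρ θ u hE Φ hLLN hT _ rfl _ rfl _ rfl _ rfl _ rfl _ rfl _ rfl _ rfl _ rfl
  have hC := HC σ hσ hσC' T ρ θ u hE Φ hLLN t ht hguardC _ rfl _ rfl _ rfl _ rfl _ rfl _ rfl _ rfl _ rfl _ rfl
  dsimp only at hA hC
  have hδ2 : 0 < δ / 2 := by positivity
  obtain ⟨mA, hmA⟩ := hA (δ / 2) hδ2
  obtain ⟨mC, hmC⟩ := hC (δ / 2) hδ2
  refine ⟨max mA mC, fun m hm => ?_⟩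
  filter_upwards [hmA m ((le_max_left _ _).trans hm), hmC m ((le_max_right _ _).trans hm)] with N hN0 hN2
  intro s hs
  have hent := HB σ hσ T ρ θ u hE t ht hguardB s hs
  rw [hent]
  linarith [hN0, hN2 s hs]

/-- **The crux modulo the three registered stubs** (becomes the crux proof when the last stub is discharged). -/
theorem NoMeanEntropyProduction_skeleton : NoMeanEntropyProduction :=
  NoMeanEntropyProduction_of Stubs.stub_initialCoarseGraining Stubs.stub_eulerEntropyConservation
    Stubs.stub_noCoarseEntropyGain

end Summit.AtomisticToContinuum.HydrodynamicLimit.Cruxes.NoMeanEntropyProduction.Birth
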